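import Summits.CriticalPhenomena.PercolationContinuityZ3.Theorems.NonProliferation.Negative.MZeroSlice
import Summits.CriticalPhenomena.PercolationContinuityZ3.Theorems.PercNonProliferationSubpolynomialBlockingStubBlockProbTwoPos
import HarnessLib

/-!
# `NonProliferation` — calibration in two dimensions: the crux's typed form is TRUE on `ℤ²`

Crux `stmt-CriticalPhenomena-4444` (`PercNonProliferation.NonProliferation`, route rank 2) is, verbatim,
the `d = 3` instance of the family `∃ M c, 0 < c ∧ ∃ᶠ n, c ≤ P_{p_c(ℤ^d)}((repEvent d M n)ᶜ)`
(`Negative.nonProliferation_iff`), and `Negative/AboveSix.lean` shows the family FALSE for every `d ≥ 7`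
under Aizenman's condition (t-c) (unconditionally for `d ≥ 11` granted Hara's `η = 0`). This file (lead c3
of line `boundary-pinning`; lands `--supports` the crux and closes nothing) records the other end of the
calibration as a kernel-checked theorem rather than a citation: **the same typed statement holds at
`d = 2`**, with `M = 0` and for ALL `n ≥ 1` (`nonProliferationDim_two`) — Aizenman's planar tightness of
the spanning-cluster number (Aizenman 1997, Thm. 3) in the weak, positive-probability form filed by the
route. Everything quantitative is already in the tree, proved for the sibling crux
`SubpolynomialBlocking` (stmt-4446) in `…SubpolynomialBlockingStubBlockProbTwoPos.lean`:
`stub_blockProb_two_pos : ∃ c > 0, ∀ n ≥ 1, c ≤ u_n(2, p_c(ℤ²))`, the ratio-2 annulus-blocking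
probability of `ℤ²` at `p_c(ℤ²) = 1/2` (Kesten), by Russo–Seymour–Welsh in the thin square annulus
`{n ≤ ‖z‖_∞ ≤ 2n}` (`Literature.Probability.Percolation.ThinAnnulus`, Harris–FKG over four `4n × n`
rectangles, duality of crossing probabilities, `rsw_lowerBound_holds` at aspect ratio `6`). Here it is
only re-read on the crux's own event: `blockProb 2 p n = P_p((annulusCrossing 2 n)ᶜ)` and
`repEvent 2 0 n = annulusCrossing 2 n` (`repEvent_zero_eq_annulusCrossing`), both definitional up to
that rewrite.

Also recorded, for the planners of the two existing items that imply the crux in `d = 3`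
(`nonProliferation_of_critAnnulusBlockedIO`, `Negative.MZeroSlice`): the `d = 2` analogues of
`PercBudgetLadder.CritAnnulusBlockedIO` (stmt-5247, `critAnnulusBlockedIO_dim_two`) and of
`PercAnnulusCrossing.CritAnnulusNonCrossing` (stmt-0846, `critAnnulusNonCrossing_dim_two`) hold, by the
same constant. So the common encoding of all three items (clusters of the open graph induced on the free
box `B(2n)`, inner box `B(n)`, inner vertex boundary `∂ⁱⁿB(2n)`) is TRUE exactly where the mathematics
says (`d = 2`) and FALSE exactly where it says (`d ≥ 7`, `Negative/AboveSix`); `d = 3` is the open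
middle (`nonProliferationDim_two_and_not_eleven`).

References: M. Aizenman, Nucl. Phys. B 485 (1997) 551–582, Thm. 3 [Aizenman1997]; B. Bollobás,
O. Riordan, *Percolation* (2006), Ch. 3 [BollobasRiordan2006]; H. Kesten, Comm. Math. Phys. 74 (1980)
41–59 [KestenCMP1980].
-/

noncomputable section

namespace Summit.CriticalPhenomena.PercolationContinuityZ3.Theorems.NonProliferation.DimTwo

open MeasureTheory Filter Topology
open Literature.Probability.LatticeModels Literature.Probability.Percolation
open Literature.Barriers.CriticalPhenomena
open Summit.CriticalPhenomena.PercolationContinuityZ3.Theorems.NonProliferation.Negative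
open Summit.CriticalPhenomena.PercolationContinuityZ3.Theorems.SubpolynomialBlocking

/-- **The critical ratio-2 annulus of `ℤ²` is blocked with probability bounded away from zero, on the
crux's event**: there is `c > 0` with `c ≤ P_{p_c(ℤ²)}((repEvent 2 0 n)ᶜ)` for every `n ≥ 1`
(`stub_blockProb_two_pos` of the sibling crux `SubpolynomialBlocking`, re-read through
`repEvent 2 0 n = annulusCrossing 2 n`). [cite: Aizenman1997, Thm. 3] -/
theorem exists_pos_le_real_repEvent_zero_compl_two :
    ∃ c : ℝ, 0 < c ∧ ∀ n : ℕ, 1 ≤ n →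
      c ≤ (bondPercolation (zdGraph 2) (criticalProbI 2)).real (repEvent 2 0 n)ᶜ := by
  obtain ⟨c, hc, hcn⟩ := stub_blockProb_two_pos
  refine ⟨c, hc, fun n hn => ?_⟩
  rw [repEvent_zero_eq_annulusCrossing]
  exact hcn n hn

/-- **The crux's typed statement is TRUE in two dimensions.** For bond percolation on `ℤ²` at
`p_c(ℤ²)` (`= 1/2`, Kesten): `∃ M c, 0 < c ∧ ∃ᶠ n, c ≤ P_{p_c(ℤ²)}((repEvent 2 M n)ᶜ)` — with `M = 0`
(no annulus-spanning box-cluster at all, with probability `≥ c`, for every `n ≥ 1`, hence frequently).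
This is the `d = 2` instance of the family whose `d = 3` instance is the crux `NonProliferation`
(`Negative.nonProliferation_iff`) and whose `d ≥ 7` instances are false (`Negative/AboveSix.lean`):
Aizenman's planar tightness of the number of spanning clusters, in the weak form filed by the route.
[cite: Aizenman1997, Thm. 3] -/
theorem nonProliferationDim_two :
    ∃ (M : ℕ) (c : ℝ), 0 < c ∧ ∃ᶠ n : ℕ in atTop,
      c ≤ (bondPercolation (zdGraph 2) (criticalProbI 2)).real (repEvent 2 M n)ᶜ := by
  obtain ⟨c, hc, hcn⟩ := exists_pos_le_real_repEvent_zero_compl_two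
  refine ⟨0, c, hc, Eventually.frequently ?_⟩
  filter_upwards [eventually_ge_atTop 1] with n hn
  exact hcn n hn

/-- **The `d = 2` analogue of `PercAnnulusCrossing.CritAnnulusNonCrossing`** (stmt-CriticalPhenomena-0846,
which implies the crux in `d = 3` with `M = 0`, `Negative.MZeroSlice`): at `p_c(ℤ²)` the ratio-2 annulus
`B(2n) ∖ B(n)` of `ℤ²` is crossed inside `B(2n)` with probability at most `1 - c` for every `n ≥ 1`.
[cite: Aizenman1997, Thm. 3] -/
theorem critAnnulusNonCrossing_dim_two :
    ∃ c : ℝ, 0 < c ∧ ∀ n : ℕ, 1 ≤ n →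
      (bondPercolation (zdGraph 2) (criticalProbI 2)).real (annulusCrossing 2 n) ≤ 1 - c := by
  obtain ⟨c, hc, hcn⟩ := stub_blockProb_two_pos
  refine ⟨c, hc, fun n hn => ?_⟩
  have h := hcn n hn
  rw [Negative.blockProb_eq] at h
  linarith

/-- **The `d = 2` analogue of `PercBudgetLadder.CritAnnulusBlockedIO`** (stmt-CriticalPhenomena-5247, the
existing item the crux is parked behind in `d = 3`, `nonProliferation_of_critAnnulusBlockedIO`): on `ℤ²`
at `p_c(ℤ²)` some aspect ratio `l ≥ 2` (here `l = 2`) has its critical annuli `B(ln) ∖ B(n)` blocked —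
no open path inside `B(ln)` from `B(n)` to `∂ⁱⁿB(ln)` — with probability `≥ c > 0` for infinitely many
(here: all positive) `n`. [cite: Aizenman1997, Thm. 3] -/
theorem critAnnulusBlockedIO_dim_two :
    ∃ (l : ℕ) (c : ℝ), 2 ≤ l ∧ 0 < c ∧ ∀ N : ℕ, ∃ n : ℕ, N ≤ n ∧ c ≤
      (bondPercolation (zdGraph 2) (criticalProbI 2)).real
        {ω | ¬ ∃ x ∈ box 2 n, ∃ y ∈ innerBoundary (zdGraph 2) (box 2 (l * n)),
          ω ∈ openConnIn (↑(box 2 (l * n)) : Set (Site 2)) x y} := by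
  obtain ⟨c, hc, hcn⟩ := stub_blockProb_two_pos
  exact ⟨2, c, le_rfl, hc, fun N => ⟨N + 1, by omega, hcn (N + 1) (by omega)⟩⟩

/-- **Calibration summary for the crux.** The statement family
`∃ M c, 0 < c ∧ ∃ᶠ n, c ≤ P_{p_c(ℤ^d)}((repEvent d M n)ᶜ)` HOLDS at `d = 2` (this file) and FAILS at
`d = 11` (`Negative.nonProliferation_false_of_hara`, granted Hara's `η = 0`); the crux is its `d = 3`
instance. So neither "true in every dimension" nor "false in every dimension" is available: the
dimension `d = 3 < 6` must enter any proof, and `d = 3 > 2` any disproof.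
[cite: Aizenman1997, Thms. 3–4] -/
theorem nonProliferationDim_two_and_not_eleven (hH : Hara2008_etaZeroXSpace) :
    (∃ (M : ℕ) (c : ℝ), 0 < c ∧ ∃ᶠ n : ℕ in atTop,
        c ≤ (bondPercolation (zdGraph 2) (criticalProbI 2)).real (repEvent 2 M n)ᶜ) ∧
      ¬ ∃ (M : ℕ) (c : ℝ), 0 < c ∧ ∃ᶠ n : ℕ in atTop,
        c ≤ (bondPercolation (zdGraph 11) (criticalProbI 11)).real (repEvent 11 M n)ᶜ :=
  ⟨nonProliferationDim_two, nonProliferation_false_of_hara hH le_rfl⟩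

end Summit.CriticalPhenomena.PercolationContinuityZ3.Theorems.NonProliferation.DimTwo

end
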